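import Mathlib
import Summits.Ventures.PercRepro2.CoinOrTailAlg
import Summits.Ventures.PercRepro2.CoinOrTailBlockAlg

/-!
# The OR-tail functional for DOMINATING markers, II: block sums and the theorem
(blind cell PercRepro2, night-2 g9 session 2; proofs/NIGHT2-DARC.md §39)

`orTailDom_functional_nonneg`: the cleared functional of row 2′DARC at an OR-tail (`rVal`/`gVal`
with the tail entries `r` (coin `ρ`) and `q` (coin `τ`)) is nonnegative for ANY two markers
`m₁, m₂ ∈ U` that DOMINATE the entries (`ν`-a.e. `r ∈ W → m₁ ∈ W` and `q ∈ W → m₂ ∈ W`): the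
entries themselves (adjacent markers), one far marker, and BOTH MARKERS FAR ON DIFFERENT ROUTES.

The four blocks `(b₁, b₂) = (1[m₁ ∈ W], 1[m₂ ∈ W])` carry the block sums
`blockR b₁ b₂ = Σ_block ν·rVal`, `blockG b₁ b₂ = Σ_block ν·gVal`; the seven moments of the
functional are sums of blocks (`sum_split_*`); `blockG ≤ blockR`; the `(0, 0)` blocks agree
(`blockG_zero_eq`: no marker ⟹ no entry ⟹ the tail is not entered); and the two
Ahlswede–Daykin steps `H1 : Λ₁₀Λ₀₁ ≤ Λ₀₀Λ₁₁` (`blockR_mul_le`), `H2 : M₁₀M₀₁ ≤ Λ₀₀M₁₁`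
(`blockG_mul_le`) follow from `Finset.four_functions_theorem`, because the blocks `(1, 0)` and
`(0, 1)` are ENTRY-DISJOINT when the markers dominate the entries (`rVal_mul_le`, `gVal_mul_le`).
`orTailBlock_nonneg` closes.
-/

namespace Summit.Ventures.PercRepro2.Coin

section BlockSums

variable {V : Type*} [DecidableEq V] {R : Type*} [Field R] [LinearOrder R] [IsStrictOrderedRing R]

/-- The `R`-block sum of the marker pattern `(b₁, b₂)`: `Σ_{W ⊆ U} ν W · rVal W · cellWt b₁ b₂ W`. -/
def blockR (U : Finset V) (ν A : Finset V → R) (m₁ m₂ r q a : V) (ρ τ : R) (b₁ b₂ : Bool) : R :=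
  ∑ W ∈ U.powerset, ν W * rVal A r q a ρ τ W * cellWt m₁ m₂ b₁ b₂ W

/-- The gate block sum of the marker pattern `(b₁, b₂)`: `Σ_{W ⊆ U} ν W · gVal W · cellWt b₁ b₂ W`. -/
def blockG (U : Finset V) (ν A : Finset V → R) (m₁ m₂ r q a w : V) (ρ τ : R) (b₁ b₂ : Bool) : R :=
  ∑ W ∈ U.powerset, ν W * gVal A r q a w ρ τ W * cellWt m₁ m₂ b₁ b₂ W

omit [LinearOrder R] [IsStrictOrderedRing R] in
/-- The four cell weights sum to `1`. -/
lemma cellWt_sum_four (m₁ m₂ : V) (W : Finset V) :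
    cellWt (R := R) m₁ m₂ false false W + cellWt m₁ m₂ false true W +
      cellWt m₁ m₂ true false W + cellWt m₁ m₂ true true W = 1 := by
  unfold cellWt mWt
  by_cases h1 : m₁ ∈ W <;> by_cases h2 : m₂ ∈ W <;> simp [h1, h2]

omit [LinearOrder R] [IsStrictOrderedRing R] in
/-- The first marker indicator is the sum of its two cell weights. -/
lemma cellWt_sum_fst (m₁ m₂ : V) (W : Finset V) :
    (if m₁ ∈ W then (1 : R) else 0) = cellWt m₁ m₂ true false W + cellWt m₁ m₂ true true W := by
  unfold cellWt mWt
  by_cases h1 : m₁ ∈ W <;> by_cases h2 : m₂ ∈ W <;> simp [h1, h2]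

omit [LinearOrder R] [IsStrictOrderedRing R] in
/-- The second marker indicator is the sum of its two cell weights. -/
lemma cellWt_sum_snd (m₁ m₂ : V) (W : Finset V) :
    (if m₂ ∈ W then (1 : R) else 0) = cellWt m₁ m₂ false true W + cellWt m₁ m₂ true true W := by
  unfold cellWt mWt
  by_cases h1 : m₁ ∈ W <;> by_cases h2 : m₂ ∈ W <;> simp [h1, h2]

omit [LinearOrder R] [IsStrictOrderedRing R] in
/-- The product of the two marker indicators is the `(1, 1)` cell weight. -/
lemma cellWt_prod (m₁ m₂ : V) (W : Finset V) :
    (if m₁ ∈ W then (1 : R) else 0) * (if m₂ ∈ W then (1 : R) else 0) =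
      cellWt m₁ m₂ true true W := by
  unfold cellWt mWt
  by_cases h1 : m₁ ∈ W <;> by_cases h2 : m₂ ∈ W <;> simp [h1, h2]

omit [LinearOrder R] [IsStrictOrderedRing R] in
/-- A nonzero cell weight pins the two memberships. -/
lemma of_cellWt_ne_zero {m₁ m₂ : V} {b₁ b₂ : Bool} {W : Finset V}
    (h : cellWt (R := R) m₁ m₂ b₁ b₂ W ≠ 0) : (m₁ ∈ W ↔ b₁ = true) ∧ (m₂ ∈ W ↔ b₂ = true) := by
  unfold cellWt mWt at h
  by_cases h1 : (m₁ ∈ W ↔ b₁ = true) <;> by_cases h2 : (m₂ ∈ W ↔ b₂ = true) <;> simp_all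

omit [LinearOrder R] [IsStrictOrderedRing R] in
/-- A sum over `U.powerset` splits into the four block sums. -/
lemma sum_split_four (U : Finset V) (f : Finset V → R) (m₁ m₂ : V) :
    ∑ W ∈ U.powerset, f W =
      ∑ W ∈ U.powerset, f W * cellWt m₁ m₂ false false W +
        ∑ W ∈ U.powerset, f W * cellWt m₁ m₂ false true W +
        ∑ W ∈ U.powerset, f W * cellWt m₁ m₂ true false W +
        ∑ W ∈ U.powerset, f W * cellWt m₁ m₂ true true W := by
  rw [← Finset.sum_add_distrib, ← Finset.sum_add_distrib, ← Finset.sum_add_distrib]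
  refine Finset.sum_congr rfl fun W _ => ?_
  rw [← mul_add, ← mul_add, ← mul_add, cellWt_sum_four, mul_one]

omit [LinearOrder R] [IsStrictOrderedRing R] in
/-- A sum weighted by the first marker splits into two block sums. -/
lemma sum_split_fst (U : Finset V) (f : Finset V → R) (m₁ m₂ : V) :
    ∑ W ∈ U.powerset, f W * (if m₁ ∈ W then (1 : R) else 0) =
      ∑ W ∈ U.powerset, f W * cellWt m₁ m₂ true false W +
        ∑ W ∈ U.powerset, f W * cellWt m₁ m₂ true true W := by
  rw [← Finset.sum_add_distrib]
  refine Finset.sum_congr rfl fun W _ => ?_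
  rw [← mul_add, cellWt_sum_fst m₁ m₂ W]

omit [LinearOrder R] [IsStrictOrderedRing R] in
/-- A sum weighted by the second marker splits into two block sums. -/
lemma sum_split_snd (U : Finset V) (f : Finset V → R) (m₁ m₂ : V) :
    ∑ W ∈ U.powerset, f W * (if m₂ ∈ W then (1 : R) else 0) =
      ∑ W ∈ U.powerset, f W * cellWt m₁ m₂ false true W +
        ∑ W ∈ U.powerset, f W * cellWt m₁ m₂ true true W := by
  rw [← Finset.sum_add_distrib]
  refine Finset.sum_congr rfl fun W _ => ?_
  rw [← mul_add, cellWt_sum_snd m₁ m₂ W]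

omit [LinearOrder R] [IsStrictOrderedRing R] in
/-- A sum weighted by both markers is the `(1, 1)` block sum. -/
lemma sum_split_both (U : Finset V) (f : Finset V → R) (m₁ m₂ : V) :
    ∑ W ∈ U.powerset, f W * ((if m₁ ∈ W then (1 : R) else 0) * (if m₂ ∈ W then (1 : R) else 0)) =
      ∑ W ∈ U.powerset, f W * cellWt m₁ m₂ true true W := by
  refine Finset.sum_congr rfl fun W _ => ?_
  rw [cellWt_prod m₁ m₂ W]

/-- `0 ≤ blockR`. -/
lemma blockR_nonneg (U : Finset V) (ν A : Finset V → R) (m₁ m₂ r q a : V) (ρ τ : R)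
    (hρ0 : 0 ≤ ρ) (hρ1 : ρ ≤ 1) (hτ0 : 0 ≤ τ) (hτ1 : τ ≤ 1)
    (hν0 : ∀ W, 0 ≤ ν W) (hA0 : ∀ W, 0 ≤ A W) (b₁ b₂ : Bool) :
    0 ≤ blockR U ν A m₁ m₂ r q a ρ τ b₁ b₂ := by
  unfold blockR
  refine Finset.sum_nonneg fun W _ => mul_nonneg (mul_nonneg (hν0 W) ?_) (cellWt_nonneg _ _ _ _ _)
  unfold rVal
  have h1 := tailWt_le_one (r := r) (q := q) hρ0 hτ0 hτ1 W
  have h2 := tailWt_nonneg (r := r) (q := q) hρ1 hτ1 W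
  have := hA0 W; have := hA0 (W ∪ {a})
  nlinarith

/-- `0 ≤ blockG`. -/
lemma blockG_nonneg (U : Finset V) (ν A : Finset V → R) (m₁ m₂ r q a w : V) (ρ τ : R)
    (hρ0 : 0 ≤ ρ) (hρ1 : ρ ≤ 1) (hτ0 : 0 ≤ τ) (hτ1 : τ ≤ 1)
    (hν0 : ∀ W, 0 ≤ ν W) (hA0 : ∀ W, 0 ≤ A W) (b₁ b₂ : Bool) :
    0 ≤ blockG U ν A m₁ m₂ r q a w ρ τ b₁ b₂ := by
  unfold blockG
  exact Finset.sum_nonneg fun W _ =>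
    mul_nonneg (mul_nonneg (hν0 W) (gVal_nonneg hρ0 hρ1 hτ0 hτ1 hA0 W)) (cellWt_nonneg _ _ _ _ _)

/-- `blockG ≤ blockR`. -/
lemma blockG_le_blockR (U : Finset V) (ν A : Finset V → R) (m₁ m₂ r q a w : V) (ρ τ : R)
    (hρ0 : 0 ≤ ρ) (hτ0 : 0 ≤ τ) (hτ1 : τ ≤ 1)
    (hν0 : ∀ W, 0 ≤ ν W) (hAmono : ∀ s t : Finset V, s ⊆ t → A t ≤ A s) (b₁ b₂ : Bool) :
    blockG U ν A m₁ m₂ r q a w ρ τ b₁ b₂ ≤ blockR U ν A m₁ m₂ r q a ρ τ b₁ b₂ := by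
  unfold blockG blockR
  refine Finset.sum_le_sum fun W _ => ?_
  exact mul_le_mul_of_nonneg_right
    (mul_le_mul_of_nonneg_left (gVal_le_rVal hρ0 hτ0 hτ1 hAmono W) (hν0 W))
    (cellWt_nonneg _ _ _ _ _)

omit [IsStrictOrderedRing R] in
/-- The `(0, 0)` blocks agree when the markers dominate the entries: without markers there are no
entries, so the tail is never entered. -/
lemma blockG_zero_eq (U : Finset V) (ν A : Finset V → R) (m₁ m₂ r q a w : V) (ρ τ : R)
    (hdom₁ : ∀ W ⊆ U, r ∈ W → m₁ ∉ W → ν W = 0)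
    (hdom₂ : ∀ W ⊆ U, q ∈ W → m₂ ∉ W → ν W = 0) :
    blockG U ν A m₁ m₂ r q a w ρ τ false false = blockR U ν A m₁ m₂ r q a ρ τ false false := by
  unfold blockG blockR
  refine Finset.sum_congr rfl fun W hW => ?_
  have hWU : W ⊆ U := Finset.mem_powerset.1 hW
  by_cases hν : ν W = 0
  · rw [hν]; ring
  by_cases hc : cellWt (R := R) m₁ m₂ false false W = 0
  · rw [hc]; ring
  obtain ⟨h1, h2⟩ := of_cellWt_ne_zero hc
  simp only [Bool.false_eq_true, iff_false] at h1 h2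
  have hr : r ∉ W := fun hr => hν (hdom₁ W hWU hr h1)
  have hq : q ∉ W := fun hq => hν (hdom₂ W hWU hq h2)
  rw [rVal_of_no_entry hr hq, gVal_of_no_entry hr hq]

/-- **H1**: the Ahlswede–Daykin step of the `R`-blocks, `Λ₁₀ Λ₀₁ ≤ Λ₀₀ Λ₁₁`, for dominating
markers. -/
theorem blockR_mul_le (U : Finset V) (ν A : Finset V → R) (m₁ m₂ r q a : V) (ρ τ : R)
    (haU : a ∉ U) (hρ0 : 0 ≤ ρ) (hρ1 : ρ ≤ 1) (hτ0 : 0 ≤ τ) (hτ1 : τ ≤ 1)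
    (hν0 : ∀ W, 0 ≤ ν W) (hν : ∀ s ⊆ U, ∀ t ⊆ U, ν s * ν t ≤ ν (s ∩ t) * ν (s ∪ t))
    (hdom₁ : ∀ W ⊆ U, r ∈ W → m₁ ∉ W → ν W = 0)
    (hdom₂ : ∀ W ⊆ U, q ∈ W → m₂ ∉ W → ν W = 0)
    (hA0 : ∀ W, 0 ≤ A W) (hA : ∀ s t : Finset V, A s * A t ≤ A (s ∩ t) * A (s ∪ t))
    (hAmono : ∀ s t : Finset V, s ⊆ t → A t ≤ A s) :
    blockR U ν A m₁ m₂ r q a ρ τ true false * blockR U ν A m₁ m₂ r q a ρ τ false true ≤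
      blockR U ν A m₁ m₂ r q a ρ τ false false * blockR U ν A m₁ m₂ r q a ρ τ true true := by
  unfold blockR
  have hr0 : ∀ W, 0 ≤ rVal A r q a ρ τ W := by
    intro W
    unfold rVal
    have h1 := tailWt_le_one (r := r) (q := q) hρ0 hτ0 hτ1 W
    have h2 := tailWt_nonneg (r := r) (q := q) hρ1 hτ1 W
    have := hA0 W; have := hA0 (W ∪ {a})
    nlinarith
  have hterm : ∀ b₁ b₂ : Bool, (0 : Finset V → R) ≤
      fun W => ν W * rVal A r q a ρ τ W * cellWt m₁ m₂ b₁ b₂ W :=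
    fun b₁ b₂ W => mul_nonneg (mul_nonneg (hν0 W) (hr0 W)) (cellWt_nonneg _ _ _ _ _)
  have h : ∀ ⦃s : Finset V⦄, s ⊆ U → ∀ ⦃t : Finset V⦄, t ⊆ U →
      (fun W => ν W * rVal A r q a ρ τ W * cellWt m₁ m₂ true false W) s *
        (fun W => ν W * rVal A r q a ρ τ W * cellWt m₁ m₂ false true W) t ≤
      (fun W => ν W * rVal A r q a ρ τ W * cellWt m₁ m₂ false false W) (s ∩ t) *
        (fun W => ν W * rVal A r q a ρ τ W * cellWt m₁ m₂ true true W) (s ∪ t) := by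
    intro s hs t ht
    simp only
    have hR : 0 ≤ ν (s ∩ t) * rVal A r q a ρ τ (s ∩ t) * cellWt m₁ m₂ false false (s ∩ t) *
        (ν (s ∪ t) * rVal A r q a ρ τ (s ∪ t) * cellWt m₁ m₂ true true (s ∪ t)) :=
      mul_nonneg (hterm false false _) (hterm true true _)
    by_cases hνs : ν s = 0
    · rw [hνs]; simpa using hR
    by_cases hνt : ν t = 0
    · rw [hνt]; simpa using hR
    by_cases hcs : cellWt (R := R) m₁ m₂ true false s = 0
    · rw [hcs]; simpa using hR
    by_cases hct : cellWt (R := R) m₁ m₂ false true t = 0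
    · rw [hct]; simpa using hR
    obtain ⟨_, hs2⟩ := of_cellWt_ne_zero hcs
    obtain ⟨ht1, _⟩ := of_cellWt_ne_zero hct
    simp only [Bool.false_eq_true, iff_false] at hs2 ht1
    have hqs : q ∉ s := fun hq => hνs (hdom₂ s hs hq hs2)
    have hrt : r ∉ t := fun hr => hνt (hdom₁ t ht hr ht1)
    have has : a ∉ s := fun h => haU (hs h)
    have hat : a ∉ t := fun h => haU (ht h)
    have hrr := rVal_mul_le hρ0 hρ1 hτ0 hτ1 hA0 hA hAmono has hat hqs hrt
    have hcc := cellWt_mul_le (R := R) m₁ m₂ true false false true s t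
    simp only [Bool.and_false, Bool.false_and, Bool.true_or, Bool.or_true] at hcc
    calc ν s * rVal A r q a ρ τ s * cellWt m₁ m₂ true false s *
          (ν t * rVal A r q a ρ τ t * cellWt m₁ m₂ false true t)
        = (ν s * ν t) * (rVal A r q a ρ τ s * rVal A r q a ρ τ t) *
            (cellWt m₁ m₂ true false s * cellWt m₁ m₂ false true t) := by ring
      _ ≤ (ν (s ∩ t) * ν (s ∪ t)) * (rVal A r q a ρ τ (s ∩ t) * rVal A r q a ρ τ (s ∪ t)) *
            (cellWt m₁ m₂ false false (s ∩ t) * cellWt m₁ m₂ true true (s ∪ t)) := by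
          apply mul_le_mul
          · apply mul_le_mul (hν s hs t ht) hrr
            · exact mul_nonneg (hr0 _) (hr0 _)
            · exact mul_nonneg (hν0 _) (hν0 _)
          · exact hcc
          · exact mul_nonneg (cellWt_nonneg _ _ _ _ _) (cellWt_nonneg _ _ _ _ _)
          · exact mul_nonneg (mul_nonneg (hν0 _) (hν0 _)) (mul_nonneg (hr0 _) (hr0 _))
      _ = ν (s ∩ t) * rVal A r q a ρ τ (s ∩ t) * cellWt m₁ m₂ false false (s ∩ t) *
            (ν (s ∪ t) * rVal A r q a ρ τ (s ∪ t) * cellWt m₁ m₂ true true (s ∪ t)) := by ring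
  have key := Finset.four_functions_theorem U (hterm true false) (hterm false true)
    (hterm false false) (hterm true true) h (𝒜 := U.powerset) (ℬ := U.powerset) le_rfl le_rfl
  simpa only [Finset.powerset_infs_powerset_self, Finset.powerset_sups_powerset_self] using key

/-- **H2**: the Ahlswede–Daykin step of the gate blocks against the `(0, 0)` `R`-block,
`M₁₀ M₀₁ ≤ Λ₀₀ M₁₁`, for dominating markers. -/
theorem blockG_mul_le (U : Finset V) (ν A : Finset V → R) (m₁ m₂ r q a w : V) (ρ τ : R)
    (haU : a ∉ U) (hwU : w ∉ U) (hρ0 : 0 ≤ ρ) (hρ1 : ρ ≤ 1) (hτ0 : 0 ≤ τ) (hτ1 : τ ≤ 1)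
    (hν0 : ∀ W, 0 ≤ ν W) (hν : ∀ s ⊆ U, ∀ t ⊆ U, ν s * ν t ≤ ν (s ∩ t) * ν (s ∪ t))
    (hdom₁ : ∀ W ⊆ U, r ∈ W → m₁ ∉ W → ν W = 0)
    (hdom₂ : ∀ W ⊆ U, q ∈ W → m₂ ∉ W → ν W = 0)
    (hA0 : ∀ W, 0 ≤ A W) (hA : ∀ s t : Finset V, A s * A t ≤ A (s ∩ t) * A (s ∪ t))
    (hAmono : ∀ s t : Finset V, s ⊆ t → A t ≤ A s) :
    blockG U ν A m₁ m₂ r q a w ρ τ true false * blockG U ν A m₁ m₂ r q a w ρ τ false true ≤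
      blockR U ν A m₁ m₂ r q a ρ τ false false * blockG U ν A m₁ m₂ r q a w ρ τ true true := by
  unfold blockG blockR
  have hg0 : ∀ W, 0 ≤ gVal A r q a w ρ τ W := gVal_nonneg hρ0 hρ1 hτ0 hτ1 hA0
  have hr0 : ∀ W, 0 ≤ rVal A r q a ρ τ W := by
    intro W
    unfold rVal
    have h1 := tailWt_le_one (r := r) (q := q) hρ0 hτ0 hτ1 W
    have h2 := tailWt_nonneg (r := r) (q := q) hρ1 hτ1 W
    have := hA0 W; have := hA0 (W ∪ {a})
    nlinarith
  have htermG : ∀ b₁ b₂ : Bool, (0 : Finset V → R) ≤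
      fun W => ν W * gVal A r q a w ρ τ W * cellWt m₁ m₂ b₁ b₂ W :=
    fun b₁ b₂ W => mul_nonneg (mul_nonneg (hν0 W) (hg0 W)) (cellWt_nonneg _ _ _ _ _)
  have htermR : (0 : Finset V → R) ≤
      fun W => ν W * rVal A r q a ρ τ W * cellWt m₁ m₂ false false W :=
    fun W => mul_nonneg (mul_nonneg (hν0 W) (hr0 W)) (cellWt_nonneg _ _ _ _ _)
  have h : ∀ ⦃s : Finset V⦄, s ⊆ U → ∀ ⦃t : Finset V⦄, t ⊆ U →
      (fun W => ν W * gVal A r q a w ρ τ W * cellWt m₁ m₂ true false W) s *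
        (fun W => ν W * gVal A r q a w ρ τ W * cellWt m₁ m₂ false true W) t ≤
      (fun W => ν W * rVal A r q a ρ τ W * cellWt m₁ m₂ false false W) (s ∩ t) *
        (fun W => ν W * gVal A r q a w ρ τ W * cellWt m₁ m₂ true true W) (s ∪ t) := by
    intro s hs t ht
    simp only
    have hR : 0 ≤ ν (s ∩ t) * rVal A r q a ρ τ (s ∩ t) * cellWt m₁ m₂ false false (s ∩ t) *
        (ν (s ∪ t) * gVal A r q a w ρ τ (s ∪ t) * cellWt m₁ m₂ true true (s ∪ t)) :=
      mul_nonneg (htermR _) (htermG true true _)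
    by_cases hνs : ν s = 0
    · rw [hνs]; simpa using hR
    by_cases hνt : ν t = 0
    · rw [hνt]; simpa using hR
    by_cases hcs : cellWt (R := R) m₁ m₂ true false s = 0
    · rw [hcs]; simpa using hR
    by_cases hct : cellWt (R := R) m₁ m₂ false true t = 0
    · rw [hct]; simpa using hR
    obtain ⟨_, hs2⟩ := of_cellWt_ne_zero hcs
    obtain ⟨ht1, _⟩ := of_cellWt_ne_zero hct
    simp only [Bool.false_eq_true, iff_false] at hs2 ht1
    have hqs : q ∉ s := fun hq => hνs (hdom₂ s hs hq hs2)
    have hrt : r ∉ t := fun hr => hνt (hdom₁ t ht hr ht1)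
    have has : a ∉ s := fun h => haU (hs h)
    have hat : a ∉ t := fun h => haU (ht h)
    have hws : w ∉ s := fun h => hwU (hs h)
    have hwt : w ∉ t := fun h => hwU (ht h)
    have hgg := gVal_mul_le hρ0 hρ1 hτ0 hτ1 hA0 hA hAmono has hat hws hwt hqs hrt
    have hrst : r ∉ s ∩ t := fun h => hrt (Finset.mem_inter.1 h).2
    have hqst : q ∉ s ∩ t := fun h => hqs (Finset.mem_inter.1 h).1
    rw [gVal_of_no_entry hrst hqst, ← rVal_of_no_entry (A := A) (a := a) (ρ := ρ) (τ := τ) hrst hqst] at hgg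
    have hcc := cellWt_mul_le (R := R) m₁ m₂ true false false true s t
    simp only [Bool.and_false, Bool.false_and, Bool.true_or, Bool.or_true] at hcc
    calc ν s * gVal A r q a w ρ τ s * cellWt m₁ m₂ true false s *
          (ν t * gVal A r q a w ρ τ t * cellWt m₁ m₂ false true t)
        = (ν s * ν t) * (gVal A r q a w ρ τ s * gVal A r q a w ρ τ t) *
            (cellWt m₁ m₂ true false s * cellWt m₁ m₂ false true t) := by ring
      _ ≤ (ν (s ∩ t) * ν (s ∪ t)) * (rVal A r q a ρ τ (s ∩ t) * gVal A r q a w ρ τ (s ∪ t)) *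
            (cellWt m₁ m₂ false false (s ∩ t) * cellWt m₁ m₂ true true (s ∪ t)) := by
          apply mul_le_mul
          · apply mul_le_mul (hν s hs t ht) hgg
            · exact mul_nonneg (hg0 _) (hg0 _)
            · exact mul_nonneg (hν0 _) (hν0 _)
          · exact hcc
          · exact mul_nonneg (cellWt_nonneg _ _ _ _ _) (cellWt_nonneg _ _ _ _ _)
          · exact mul_nonneg (mul_nonneg (hν0 _) (hν0 _)) (mul_nonneg (hr0 _) (hg0 _))
      _ = ν (s ∩ t) * rVal A r q a ρ τ (s ∩ t) * cellWt m₁ m₂ false false (s ∩ t) *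
            (ν (s ∪ t) * gVal A r q a w ρ τ (s ∪ t) * cellWt m₁ m₂ true true (s ∪ t)) := by ring
  have key := Finset.four_functions_theorem U (htermG true false) (htermG false true)
    htermR (htermG true true) h (𝒜 := U.powerset) (ℬ := U.powerset) le_rfl le_rfl
  simpa only [Finset.powerset_infs_powerset_self, Finset.powerset_sups_powerset_self] using key

/-- **THE OR-TAIL FUNCTIONAL IS NONNEGATIVE FOR DOMINATING MARKERS** (block theorem).
Hypotheses: `a, w ∉ U`; `ρ, τ ∈ [0, 1]` the tail coins of the entries `r, q`; `ν ≥ 0`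
log-supermodular on the subsets of `U`; the markers `m₁, m₂` dominate the entries
(`hdom₁ : r ∈ W → m₁ ∉ W → ν W = 0`, `hdom₂ : q ∈ W → m₂ ∉ W → ν W = 0`); `A ≥ 0` decreasing and
log-supermodular.  Conclusion: the cleared functional `Λ² XY − Λ F_a Y − Λ F_b X + F_a F_b M ≥ 0`
with `Λ = Σ ν·rVal`, `F_a = Σ ν·rVal·1[m₁ ∈ W]`, `F_b = Σ ν·rVal·1[m₂ ∈ W]`, `M = Σ ν·gVal`,
`X = Σ ν·gVal·1[m₁ ∈ W]`, `Y = Σ ν·gVal·1[m₂ ∈ W]`, `XY = Σ ν·gVal·1[m₁ ∈ W]·1[m₂ ∈ W]`. -/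
theorem orTailDom_functional_nonneg (U : Finset V) (ν A : Finset V → R) (m₁ m₂ r q a w : V)
    (ρ τ : R) (haU : a ∉ U) (hwU : w ∉ U)
    (hρ0 : 0 ≤ ρ) (hρ1 : ρ ≤ 1) (hτ0 : 0 ≤ τ) (hτ1 : τ ≤ 1)
    (hν0 : ∀ W, 0 ≤ ν W) (hν : ∀ s ⊆ U, ∀ t ⊆ U, ν s * ν t ≤ ν (s ∩ t) * ν (s ∪ t))
    (hdom₁ : ∀ W ⊆ U, r ∈ W → m₁ ∉ W → ν W = 0)
    (hdom₂ : ∀ W ⊆ U, q ∈ W → m₂ ∉ W → ν W = 0)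
    (hA0 : ∀ W, 0 ≤ A W) (hA : ∀ s t : Finset V, A s * A t ≤ A (s ∩ t) * A (s ∪ t))
    (hAmono : ∀ s t : Finset V, s ⊆ t → A t ≤ A s) :
    0 ≤ (∑ W ∈ U.powerset, ν W * rVal A r q a ρ τ W) ^ 2 *
          (∑ W ∈ U.powerset, ν W * gVal A r q a w ρ τ W *
            ((if m₁ ∈ W then (1 : R) else 0) * (if m₂ ∈ W then (1 : R) else 0)))
        - (∑ W ∈ U.powerset, ν W * rVal A r q a ρ τ W) *
          (∑ W ∈ U.powerset, ν W * rVal A r q a ρ τ W * (if m₁ ∈ W then (1 : R) else 0)) *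
          (∑ W ∈ U.powerset, ν W * gVal A r q a w ρ τ W * (if m₂ ∈ W then (1 : R) else 0))
        - (∑ W ∈ U.powerset, ν W * rVal A r q a ρ τ W) *
          (∑ W ∈ U.powerset, ν W * rVal A r q a ρ τ W * (if m₂ ∈ W then (1 : R) else 0)) *
          (∑ W ∈ U.powerset, ν W * gVal A r q a w ρ τ W * (if m₁ ∈ W then (1 : R) else 0))
        + (∑ W ∈ U.powerset, ν W * rVal A r q a ρ τ W * (if m₁ ∈ W then (1 : R) else 0)) *
          (∑ W ∈ U.powerset, ν W * rVal A r q a ρ τ W * (if m₂ ∈ W then (1 : R) else 0)) *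
          (∑ W ∈ U.powerset, ν W * gVal A r q a w ρ τ W) := by
  rw [sum_split_four U (fun W => ν W * rVal A r q a ρ τ W) m₁ m₂,
    sum_split_four U (fun W => ν W * gVal A r q a w ρ τ W) m₁ m₂,
    sum_split_fst U (fun W => ν W * rVal A r q a ρ τ W) m₁ m₂,
    sum_split_snd U (fun W => ν W * rVal A r q a ρ τ W) m₁ m₂,
    sum_split_fst U (fun W => ν W * gVal A r q a w ρ τ W) m₁ m₂,
    sum_split_snd U (fun W => ν W * gVal A r q a w ρ τ W) m₁ m₂,
    sum_split_both U (fun W => ν W * gVal A r q a w ρ τ W) m₁ m₂]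
  have e1 : ∀ b₁ b₂, ∑ W ∈ U.powerset, ν W * rVal A r q a ρ τ W * cellWt m₁ m₂ b₁ b₂ W =
      blockR U ν A m₁ m₂ r q a ρ τ b₁ b₂ := fun _ _ => rfl
  have e2 : ∀ b₁ b₂, ∑ W ∈ U.powerset, ν W * gVal A r q a w ρ τ W * cellWt m₁ m₂ b₁ b₂ W =
      blockG U ν A m₁ m₂ r q a w ρ τ b₁ b₂ := fun _ _ => rfl
  simp only [e1, e2]
  exact orTailBlock_nonneg _ _ _ _ _ _ _ _
    (blockR_nonneg U ν A m₁ m₂ r q a ρ τ hρ0 hρ1 hτ0 hτ1 hν0 hA0 false false)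
    (blockG_nonneg U ν A m₁ m₂ r q a w ρ τ hρ0 hρ1 hτ0 hτ1 hν0 hA0 false true)
    (blockG_nonneg U ν A m₁ m₂ r q a w ρ τ hρ0 hρ1 hτ0 hτ1 hν0 hA0 true false)
    (blockG_nonneg U ν A m₁ m₂ r q a w ρ τ hρ0 hρ1 hτ0 hτ1 hν0 hA0 true true)
    (blockG_le_blockR U ν A m₁ m₂ r q a w ρ τ hρ0 hτ0 hτ1 hν0 hAmono false true)
    (blockG_le_blockR U ν A m₁ m₂ r q a w ρ τ hρ0 hτ0 hτ1 hν0 hAmono true false)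
    (blockG_le_blockR U ν A m₁ m₂ r q a w ρ τ hρ0 hτ0 hτ1 hν0 hAmono true true)
    (blockG_zero_eq U ν A m₁ m₂ r q a w ρ τ hdom₁ hdom₂)
    (blockR_mul_le U ν A m₁ m₂ r q a ρ τ haU hρ0 hρ1 hτ0 hτ1 hν0 hν hdom₁ hdom₂ hA0 hA hAmono)
    (blockG_mul_le U ν A m₁ m₂ r q a w ρ τ haU hwU hρ0 hρ1 hτ0 hτ1 hν0 hν hdom₁ hdom₂ hA0 hA
      hAmono)

end BlockSums

end Summit.Ventures.PercRepro2.Coin
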